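/-
Copyright (c) 2026 the pub-hodgecm-mathlib formalisation cell (harness21).  Prover seat hodgecm-mathlib-B-p14 (g31) (Layer B′ design pen), (F11-c) LAYER B′ (b′)+(c): Prop. 16's
per-`m` table `iSixteenM` and Prop. 17's sum `phiTHprimeM` for an element of `Stab(w₀)` of type-(2) sizes (architect A-p06 (g26); LEAD F0P3a-plan (g9) T8-104 (4)), 2026-09-01.
-/
import Literature.NumberTheory.Automorphic.UnitaryThreeAnisotropicFixedPointCountRegimeOne   -- ★ p841907 (this seat): rows `2m ≤ N`, `m > N`, `N₂ < N` (all or none)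
import Literature.NumberTheory.Automorphic.UnitaryThreeAnisotropicStabilizerCosetCount      -- ★ p841902 (A-p13 2e-β): `#(S ⧸ H′_m) = (q+1)q^{4m}`
import Literature.NumberTheory.Rogawski1990.UnitOrbitalIntegralInertSumsTypeTwo             -- ★ p841602 (B-p14 g30): `iSixteenM`, `Σᶠ_m iSixteenM = phiTHprimeM`
import HarnessLib

/-!
# Flicker's Propositions 16–17 for the κ = −1 class: `#{y ∈ U ⧸ K₀ : t·y = y} = phiTHprimeM q M N` for `t ∈ Stab(w₀)` of type-(2) sizes, modulo the ONE regime-2 count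
# (Flicker 1998, Prop. 5 p. 82, Prop. 16 p. 96, Prop. 17 p. 97)

Topic `NumberTheory/Automorphic`; namespace `Literature.NumberTheory.Automorphic.UnitaryGroup`.  THEOREMS ONLY (no `def`, no instance, no notation, no named fact,
no `sorry`; count-neutral).  Cell `pub/hodgecm-mathlib`, crux H413 = `stmt-HodgeConjecture-24833`, line «N7nsCount» ED. 1.5, value stub `stub_irredGValueNeg` (:1194).
LAYER B′ assembled: for `t ∈ S = Stab(w₀)` with (C′) coordinates `(b_t,q_t,r_t,s_t)`, `A_t = 1+4ϖb_t`, of TYPE-(2) SIZES `|q_t| = |ϖ|^N`, `|A_t − s_t| ≤ |ϖ|^{N+1}` and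
`M`-datum (`M ≤ N ⇒ |A_t − 1| = |ϖ|^M`; `N < M ⇒ |A_t − 1| ≤ |ϖ|^{N+1}` — the dictionary of ★ (d2) `v_sub_one_eq_of_lt` ∕ `v_sub_one_le_of_le`):
* §1 `finite_fixedPoints_unitaryInt_of_mem_stabilizer` — `{y ∈ U ⧸ K₀ : t·y = y}` is FINITE (★ (F2′) Σ-bijection; each `S ⧸ H′_m` finite by ★ 2e-β; no fixed coset for `m > N`);
* §2 **`natCard_fixedPoints_stabilizer_quotient_eq_iSixteenM`** — the per-`m` TABLE `#Fix_t(S ⧸ H′_m) = iSixteenM q M N m`, by cases on ★ p841907's rows + ★ 2e-β, with the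
  single cell `N < M ∧ [N∕2] < m ≤ N ⇒ (q+1)q^{N+2m}` taken as the hypothesis `hβ` (B-p10 (g25)'s FILE β — Flicker's σ-semilinear congruence count; ★-pending);
* §3 **`natCard_fixedPoints_unitaryInt_eq_phiTHprimeM`** — `#{y ∈ U ⧸ K₀ : t·y = y} = phiTHprimeM q M N` (★ (F2′) `Σᶠ_m` ∘ §2 ∘ ★ `finsum_iSixteenM_eq_phiTHprimeM`), modulo `hβ`.
With ★ (d1)∕(d2) (normal form), ★ p841969 (`phiTHprimen ↔ phiTHprimeM`) and the frame discharge this is the value `Φ(⟦δ⟧, 1_{K′}) = phiTHprimen q n N` of :1194.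
HONEST LABEL: HC_CM is proved only modulo the printed citations until rung 0 closes; structure theory feeding ONE value stub of #103-ns, pays nothing by itself.

## References
* [Flicker1998UnitaryFL] Y. Z. Flicker, *Elementary proof of the fundamental lemma for a unitary group*, Canad. J. Math. 50 (1998), Prop. 5 p. 82, Prop. 16 p. 96,
  Prop. 17 p. 97.
-/

set_option autoImplicit false

noncomputable section

open scoped MatrixGroups WithZero Valued
open Matrix

namespace Literature.NumberTheory.Automorphic

namespace UnitaryGroup

open Literature.NumberTheory.Automorphic.HermitianLattice
open Literature.NumberTheory.Rogawski1990.Flicker1998 (iSixteenM phiTHprimeM finsum_iSixteenM_eq_phiTHprimeM iSixteenM_eq_zero_of_lt)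

variable {K : Type*} [Field K] [Valued K ℤᵐ⁰] {ϖ : K}
  (σ : K →+* K) {J : Matrix (Fin 3) (Fin 3) K} (hJ : J = (StdForm.antidiagonal 3).over K)

/-! ## §1 Finiteness of the fixed-point set on `U ⧸ K₀` -/

set_option synthInstance.maxHeartbeats 200000 in
-- the `S`-action on `S ⧸ H′_m` is found through the large subgroup terms of the `U(2,1)` frame (as in ★ (F2′))
include hJ in
/-- **`{y ∈ U ⧸ K₀ : t·y = y}` is finite** for `t ∈ Stab(w₀)` of type-(2) sizes: by ★ (F2′) it is `Σ_m Fix_t(S ⧸ H′_m)`, each `S ⧸ H′_m` is finite (★ 2e-β: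
cardinality `(q+1)q^{4m}`), and no coset is fixed for `m > N` (★ `smul_mk_eq_mk_iff_le_and_cond00`). [cite: Flicker1998UnitaryFL, Prop. 5 p. 82; Prop. 16 p. 96] -/
theorem finite_fixedPoints_unitaryInt_of_mem_stabilizer (hd : LocalConjDatum σ ϖ) (hσO : ∀ y : 𝒪[K], (σ.comp 𝒪[K].subtype) y ∈ 𝒪[K])
    [IsDiscreteValuationRing 𝒪[K]] [Finite (IsLocalRing.ResidueField 𝒪[K])] [IsAdicComplete 𝓂[K] 𝒪[K]]
    {a₀ : 𝒪[K]} (ha₀ : IsUnit (((σ.comp 𝒪[K].subtype).codRestrict 𝒪[K] hσO) a₀ - a₀)) {q : ℕ} (hq : Nat.card (IsLocalRing.ResidueField 𝒪[K]) = q ^ 2)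
    (d : ℕ → ↥(unitaryGroupOfForm σ J)) (hdm : ∀ m, ((d m : GL (Fin 3) K) : Matrix (Fin 3) (Fin 3) K) = !![ϖ ^ m, 0, 0; 0, 1, 0; 0, 0, (ϖ ^ m)⁻¹])
    {t : ↥(unitaryGroupOfForm σ J)} (htS : t ∈ MulAction.stabilizer (↥(unitaryGroupOfForm σ J)) (![1, 0, -(2 * ϖ)] : Fin 3 → K))
    {bt qt rt st : K}
    (ht : ((t : GL (Fin 3) K) : Matrix (Fin 3) (Fin 3) K) = !![1 + 2 * ϖ * bt, qt, bt; 2 * ϖ * rt, st, rt; 4 * ϖ ^ 2 * bt, 2 * ϖ * qt, 1 + 2 * ϖ * bt])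
    (N : ℕ) (hqt : Valued.v qt = WithZero.exp (-(N : ℤ))) (hAst : Valued.v ((1 + 4 * ϖ * bt) - st) ≤ WithZero.exp (-((N : ℤ) + 1))) :
    {y : ↥(unitaryGroupOfForm σ J) ⧸ unitaryInt σ J | t • y = y}.Finite := by
  obtain ⟨e⟩ := exists_equiv_fixedPoints_sigma_flickerDiag σ hJ hd d hdm htS
  -- each `S ⧸ H′_m` is finite
  have hfinm : ∀ m, Finite (↥(MulAction.stabilizer (↥(unitaryGroupOfForm σ J)) (![1, 0, -(2 * ϖ)] : Fin 3 → K)) ⧸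
      ((unitaryInt σ J).map (MulAut.conj (d m)).toMonoidHom).subgroupOf
        (MulAction.stabilizer (↥(unitaryGroupOfForm σ J)) (![1, 0, -(2 * ϖ)] : Fin 3 → K))) := fun m => by
    apply Nat.finite_of_card_ne_zero
    rw [natCard_stabilizer_quotient_conjInt_eq σ hJ hd hσO ha₀ hq d m (hdm m)]
    have hq0 : q ≠ 0 := by
      rintro rfl
      rw [zero_pow two_ne_zero] at hq
      exact (Nat.card_pos (α := IsLocalRing.ResidueField 𝒪[K])).ne' hq
    positivity
  -- fixed cosets only occur for `m ≤ N`
  have hle : ∀ m (z : ↥(MulAction.stabilizer (↥(unitaryGroupOfForm σ J)) (![1, 0, -(2 * ϖ)] : Fin 3 → K)) ⧸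
      ((unitaryInt σ J).map (MulAut.conj (d m)).toMonoidHom).subgroupOf
        (MulAction.stabilizer (↥(unitaryGroupOfForm σ J)) (![1, 0, -(2 * ϖ)] : Fin 3 → K))),
      (⟨t, htS⟩ : ↥(MulAction.stabilizer (↥(unitaryGroupOfForm σ J)) (![1, 0, -(2 * ϖ)] : Fin 3 → K))) • z = z → m ≤ N := by
    intro m z hz
    induction z using QuotientGroup.induction_on with
    | H h =>
      obtain ⟨b, q', r, s, hh⟩ := exists_coe_eq_of_mulVec_anisoVec_eq σ hJ hd
        ((mem_stabilizer_anisoVec_iff σ _ (h : ↥(unitaryGroupOfForm σ J))).1 h.2)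
      exact ((smul_mk_eq_mk_iff_le_and_cond00 σ hJ hd d m (hdm m) htS ht N hqt hAst h hh).1 hz).1
  -- so the Σ-type injects into a finite Σ-type over `Fin (N + 1)`
  haveI : Finite (Σ m : ℕ, {z : ↥(MulAction.stabilizer (↥(unitaryGroupOfForm σ J)) (![1, 0, -(2 * ϖ)] : Fin 3 → K)) ⧸
      ((unitaryInt σ J).map (MulAut.conj (d m)).toMonoidHom).subgroupOf
        (MulAction.stabilizer (↥(unitaryGroupOfForm σ J)) (![1, 0, -(2 * ϖ)] : Fin 3 → K)) //
      (⟨t, htS⟩ : ↥(MulAction.stabilizer (↥(unitaryGroupOfForm σ J)) (![1, 0, -(2 * ϖ)] : Fin 3 → K))) • z = z}) := by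
    refine Finite.of_injective
      (β := Σ m : Fin (N + 1), {z : ↥(MulAction.stabilizer (↥(unitaryGroupOfForm σ J)) (![1, 0, -(2 * ϖ)] : Fin 3 → K)) ⧸
        ((unitaryInt σ J).map (MulAut.conj (d m)).toMonoidHom).subgroupOf
          (MulAction.stabilizer (↥(unitaryGroupOfForm σ J)) (![1, 0, -(2 * ϖ)] : Fin 3 → K)) //
        (⟨t, htS⟩ : ↥(MulAction.stabilizer (↥(unitaryGroupOfForm σ J)) (![1, 0, -(2 * ϖ)] : Fin 3 → K))) • z = z})
      (fun x => ⟨⟨x.1, Nat.lt_succ_of_le (hle x.1 x.2.1 x.2.2)⟩, x.2⟩) ?_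
    rintro ⟨m, z⟩ ⟨m', z'⟩ h
    simp only [Sigma.mk.injEq, Fin.mk.injEq] at h
    obtain ⟨rfl, hzz⟩ := h
    simp only [heq_eq_eq] at hzz
    subst hzz
    rfl
  exact Set.finite_coe_iff.1 (Finite.of_equiv _ e.symm)

/-! ## §2 The per-`m` table `iSixteenM` (Prop. 16), modulo the regime-2 count `hβ` -/

/-- `m ≤ (M − 1) ∕ 2 ↔ 2m + 1 ≤ M` for `1 ≤ M` (bookkeeping between the table's index bound and the congruence exponent). [folklore] -/
private theorem le_sub_one_div_two_iff {m M : ℕ} (hM : 1 ≤ M) : m ≤ (M - 1) / 2 ↔ 2 * m + 1 ≤ M := by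
  rw [Nat.le_div_iff_mul_le two_pos]
  omega

set_option synthInstance.maxHeartbeats 200000 in
-- as above
include hJ in
/-- **PROPOSITION 16 — THE PER-`m` TABLE.**  For `t ∈ S` of type-(2) sizes `(N, M)`: `#Fix_t(S ⧸ H′_m) = iSixteenM q M N m` for every `m`, i.e. `(q+1)q^{4m}` for
`m ≤ min([N∕2],[(M−1)∕2])` (`M ≥ 1`), `(q+1)q^{N+2m}` for `N < M ∧ [N∕2] < m ≤ N`, `0` otherwise — the rows `2m ≤ N`, `m > N`, `M ≤ N` by ★ p841907 (all or none) and ★ 2e-β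
(`#(S ⧸ H′_m) = (q+1)q^{4m}`); the one GENUINE congruence count (`N < M`, `[N∕2] < m ≤ N`) is the hypothesis `hβ` (B-p10's FILE β).
[cite: Flicker1998UnitaryFL, Prop. 16 p. 96] -/
theorem natCard_fixedPoints_stabilizer_quotient_eq_iSixteenM (hd : LocalConjDatum σ ϖ) (hσO : ∀ y : 𝒪[K], (σ.comp 𝒪[K].subtype) y ∈ 𝒪[K])
    [IsDiscreteValuationRing 𝒪[K]] [Finite (IsLocalRing.ResidueField 𝒪[K])] [IsAdicComplete 𝓂[K] 𝒪[K]]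
    {a₀ : 𝒪[K]} (ha₀ : IsUnit (((σ.comp 𝒪[K].subtype).codRestrict 𝒪[K] hσO) a₀ - a₀)) {q : ℕ} (hq : Nat.card (IsLocalRing.ResidueField 𝒪[K]) = q ^ 2)
    (d : ℕ → ↥(unitaryGroupOfForm σ J)) (hdm : ∀ m, ((d m : GL (Fin 3) K) : Matrix (Fin 3) (Fin 3) K) = !![ϖ ^ m, 0, 0; 0, 1, 0; 0, 0, (ϖ ^ m)⁻¹])
    {t : ↥(unitaryGroupOfForm σ J)} (htS : t ∈ MulAction.stabilizer (↥(unitaryGroupOfForm σ J)) (![1, 0, -(2 * ϖ)] : Fin 3 → K))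
    {bt qt rt st : K}
    (ht : ((t : GL (Fin 3) K) : Matrix (Fin 3) (Fin 3) K) = !![1 + 2 * ϖ * bt, qt, bt; 2 * ϖ * rt, st, rt; 4 * ϖ ^ 2 * bt, 2 * ϖ * qt, 1 + 2 * ϖ * bt])
    (N M : ℕ) (hqt : Valued.v qt = WithZero.exp (-(N : ℤ))) (hAst : Valued.v ((1 + 4 * ϖ * bt) - st) ≤ WithZero.exp (-((N : ℤ) + 1)))
    (hMle : M ≤ N → Valued.v ((1 + 4 * ϖ * bt) - 1) = WithZero.exp (-(M : ℤ)))
    (hMgt : N < M → Valued.v ((1 + 4 * ϖ * bt) - 1) ≤ WithZero.exp (-((N : ℤ) + 1)))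
    (hβ : ∀ m : ℕ, N < 2 * m → m ≤ N → N < M →
      Nat.card {z : ↥(MulAction.stabilizer (↥(unitaryGroupOfForm σ J)) (![1, 0, -(2 * ϖ)] : Fin 3 → K)) ⧸
          ((unitaryInt σ J).map (MulAut.conj (d m)).toMonoidHom).subgroupOf
            (MulAction.stabilizer (↥(unitaryGroupOfForm σ J)) (![1, 0, -(2 * ϖ)] : Fin 3 → K)) |
        (⟨t, htS⟩ : ↥(MulAction.stabilizer (↥(unitaryGroupOfForm σ J)) (![1, 0, -(2 * ϖ)] : Fin 3 → K))) • z = z} = (q + 1) * q ^ (N + 2 * m))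
    (m : ℕ) :
    (Nat.card {z : ↥(MulAction.stabilizer (↥(unitaryGroupOfForm σ J)) (![1, 0, -(2 * ϖ)] : Fin 3 → K)) ⧸
          ((unitaryInt σ J).map (MulAut.conj (d m)).toMonoidHom).subgroupOf
            (MulAction.stabilizer (↥(unitaryGroupOfForm σ J)) (![1, 0, -(2 * ϖ)] : Fin 3 → K)) |
        (⟨t, htS⟩ : ↥(MulAction.stabilizer (↥(unitaryGroupOfForm σ J)) (![1, 0, -(2 * ϖ)] : Fin 3 → K))) • z = z} : ℚ) =
      iSixteenM q M N m := by
  have hvpow : ∀ k : ℕ, Valued.v (ϖ ^ k) = WithZero.exp (-(k : ℤ)) := fun k => by rw [hd.v_pow]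
  have hindex := natCard_stabilizer_quotient_conjInt_eq σ hJ hd hσO ha₀ hq d m (hdm m)
  rcases Nat.lt_or_ge N m with hNm | hmN
  · -- row `m > N`: no fixed coset
    rw [natCard_fixedPoints_stabilizer_quotient_eq_zero_of_lt σ hJ hd d m (hdm m) htS ht N hqt hAst hNm]
    unfold iSixteenM
    rw [if_neg, if_neg] <;> [simp; omega; skip]
    rintro ⟨-, h⟩
    have := (le_min_iff.1 h).1
    omega
  rcases Nat.lt_or_ge N M with hNM | hMN
  · -- `N < M`: `|A_t − 1| ≤ |ϖ|^{N+1}`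
    have hA1 := hMgt hNM
    rcases Nat.lt_or_ge N (2 * m) with hN2m | h2mN
    · -- regime 2: the congruence count `hβ`
      rw [hβ m hN2m hmN hNM]
      unfold iSixteenM
      rw [if_neg, if_pos ⟨hNM, by omega, hmN⟩]
      · push_cast; ring
      · rintro ⟨-, h⟩
        have := (le_min_iff.1 h).1
        omega
    · -- regime 1, all cosets fixed
      rw [natCard_fixedPoints_stabilizer_quotient_eq_ite_of_two_mul_le σ hJ hd d m (hdm m) htS ht N hqt hAst h2mN, if_pos, hindex]
      · unfold iSixteenM
        rw [if_pos ⟨by omega, le_min (by omega) ((le_sub_one_div_two_iff (by omega)).2 (by omega))⟩]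
        push_cast; ring
      · rw [hvpow]
        refine le_trans hA1 ?_
        rw [WithZero.exp_le_exp]; push_cast; omega
  · -- `M ≤ N`: `|A_t − 1| = |ϖ|^M`, all or none on `2m + 1 ≤ M`
    have hA1 := hMle hMN
    have hlt : WithZero.exp (-((N : ℤ) + 1)) < Valued.v ((1 + 4 * ϖ * bt) - 1) := by
      rw [hA1, WithZero.exp_lt_exp]; omega
    rw [natCard_fixedPoints_stabilizer_quotient_eq_ite_of_lt_v_sub_one σ hJ hd d m (hdm m) htS ht N hqt hAst hlt]
    by_cases h2m : 2 * m + 1 ≤ M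
    · rw [if_pos ⟨hmN, by rw [hA1, hvpow, WithZero.exp_le_exp]; push_cast; omega⟩, hindex]
      unfold iSixteenM
      rw [if_pos ⟨by omega, le_min (by omega) ((le_sub_one_div_two_iff (by omega)).2 h2m)⟩]
      push_cast; ring
    · rw [if_neg]
      · unfold iSixteenM
        rw [if_neg, if_neg] <;> [simp; exact fun h => (not_lt.2 hMN) h.1; skip]
        rintro ⟨h1, h⟩
        exact h2m ((le_sub_one_div_two_iff h1).1 (le_min_iff.1 h).2)
      · rintro ⟨-, h⟩
        rw [hA1, hvpow, WithZero.exp_le_exp] at h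
        push_cast at h; omega

/-! ## §3 The sum: Proposition 17 -/

set_option synthInstance.maxHeartbeats 200000 in
-- as above
include hJ in
/-- **PROPOSITION 17 (κ = −1 VALUE IN NORMAL-FORM POSITION)**: for `t ∈ Stab(w₀)` of type-(2) sizes `(N, M)`, **`#{y ∈ U ⧸ K₀ : t·y = y} = phiTHprimeM q M N`** — Flicker's
`Φ′(t″) = Σ_m ∫_{H′∕H′_m} 1_{H′_m}(h⁻¹t′h) dh` with counting measures (★ (F2′)), the per-`m` table (§2) and ★ `finsum_iSixteenM_eq_phiTHprimeM`; modulo the regime-2 count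
`hβ`. [cite: Flicker1998UnitaryFL, Prop. 5 p. 82; Prop. 16 p. 96; Prop. 17 p. 97] -/
theorem natCard_fixedPoints_unitaryInt_eq_phiTHprimeM (hd : LocalConjDatum σ ϖ) (hσO : ∀ y : 𝒪[K], (σ.comp 𝒪[K].subtype) y ∈ 𝒪[K])
    [IsDiscreteValuationRing 𝒪[K]] [Finite (IsLocalRing.ResidueField 𝒪[K])] [IsAdicComplete 𝓂[K] 𝒪[K]]
    {a₀ : 𝒪[K]} (ha₀ : IsUnit (((σ.comp 𝒪[K].subtype).codRestrict 𝒪[K] hσO) a₀ - a₀)) {q : ℕ} (hq : Nat.card (IsLocalRing.ResidueField 𝒪[K]) = q ^ 2)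
    (hq1 : 1 < q)
    (d : ℕ → ↥(unitaryGroupOfForm σ J)) (hdm : ∀ m, ((d m : GL (Fin 3) K) : Matrix (Fin 3) (Fin 3) K) = !![ϖ ^ m, 0, 0; 0, 1, 0; 0, 0, (ϖ ^ m)⁻¹])
    {t : ↥(unitaryGroupOfForm σ J)} (htS : t ∈ MulAction.stabilizer (↥(unitaryGroupOfForm σ J)) (![1, 0, -(2 * ϖ)] : Fin 3 → K))
    {bt qt rt st : K}
    (ht : ((t : GL (Fin 3) K) : Matrix (Fin 3) (Fin 3) K) = !![1 + 2 * ϖ * bt, qt, bt; 2 * ϖ * rt, st, rt; 4 * ϖ ^ 2 * bt, 2 * ϖ * qt, 1 + 2 * ϖ * bt])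
    (N M : ℕ) (hqt : Valued.v qt = WithZero.exp (-(N : ℤ))) (hAst : Valued.v ((1 + 4 * ϖ * bt) - st) ≤ WithZero.exp (-((N : ℤ) + 1)))
    (hMle : M ≤ N → Valued.v ((1 + 4 * ϖ * bt) - 1) = WithZero.exp (-(M : ℤ)))
    (hMgt : N < M → Valued.v ((1 + 4 * ϖ * bt) - 1) ≤ WithZero.exp (-((N : ℤ) + 1)))
    (hβ : ∀ m : ℕ, N < 2 * m → m ≤ N → N < M →
      Nat.card {z : ↥(MulAction.stabilizer (↥(unitaryGroupOfForm σ J)) (![1, 0, -(2 * ϖ)] : Fin 3 → K)) ⧸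
          ((unitaryInt σ J).map (MulAut.conj (d m)).toMonoidHom).subgroupOf
            (MulAction.stabilizer (↥(unitaryGroupOfForm σ J)) (![1, 0, -(2 * ϖ)] : Fin 3 → K)) |
        (⟨t, htS⟩ : ↥(MulAction.stabilizer (↥(unitaryGroupOfForm σ J)) (![1, 0, -(2 * ϖ)] : Fin 3 → K))) • z = z} = (q + 1) * q ^ (N + 2 * m)) :
    (Nat.card {y : ↥(unitaryGroupOfForm σ J) ⧸ unitaryInt σ J | t • y = y} : ℚ) = phiTHprimeM q M N := by
  have hfin := finite_fixedPoints_unitaryInt_of_mem_stabilizer σ hJ hd hσO ha₀ hq d hdm htS ht N hqt hAst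
  rw [natCard_fixedPoints_unitaryInt_eq_finsum_flickerDiag σ hJ hd d hdm htS hfin, ← finsum_iSixteenM_eq_phiTHprimeM hq1 M N]
  -- the summands vanish for `m > N`, so the support is finite and the cast commutes with `Σᶠ`
  have hsupp : (Function.support fun m : ℕ =>
      Nat.card {z : ↥(MulAction.stabilizer (↥(unitaryGroupOfForm σ J)) (![1, 0, -(2 * ϖ)] : Fin 3 → K)) ⧸
          ((unitaryInt σ J).map (MulAut.conj (d m)).toMonoidHom).subgroupOf
            (MulAction.stabilizer (↥(unitaryGroupOfForm σ J)) (![1, 0, -(2 * ϖ)] : Fin 3 → K)) |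
        (⟨t, htS⟩ : ↥(MulAction.stabilizer (↥(unitaryGroupOfForm σ J)) (![1, 0, -(2 * ϖ)] : Fin 3 → K))) • z = z}).Finite := by
    refine (Set.finite_Iic N).subset fun m hm => ?_
    rw [Function.mem_support] at hm
    rw [Set.mem_Iic]
    by_contra hNm
    exact hm (natCard_fixedPoints_stabilizer_quotient_eq_zero_of_lt σ hJ hd d m (hdm m) htS ht N hqt hAst (not_le.1 hNm))
  have hcast := (Nat.castAddMonoidHom ℚ).map_finsum hsupp
  simp only [Nat.coe_castAddMonoidHom] at hcast
  rw [hcast]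
  exact finsum_congr fun m => natCard_fixedPoints_stabilizer_quotient_eq_iSixteenM σ hJ hd hσO ha₀ hq d hdm htS ht N M hqt hAst hMle hMgt hβ m

end UnitaryGroup

end Literature.NumberTheory.Automorphic

end
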